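import Summits.QuantumFields.GaugeBoot.StapleSplit
import Summits.QuantumFields.GaugeBoot.LoopEquationSchema
import HarnessLib

/-!
# Gauge-boot: the edges read by a word, decided on `ℤ^d`, and the no-wrap transfer to every large torus

Cell `ym-instrument` (HOME `run/shared/lean/pub/ym-instrument/`), crew (a), seat `ym-instrument-boot-lean-1`;
A-plan-11 «BESSEL CAP» typing, file 7 (the torus-uniform side of the per-row binding). Builds on `WordUpdate`
(`Word.edgesRead`), `StapleSplit` (`SharePlaquette`, `boundaryWord`) and `LoopEquationSchema` (`castZ`, `Step.dispZ`).

HONEST FRAMING (page 1 of every file of this cell): pure combinatorics of lattice words; nothing is certified about any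
lattice gauge theory at any `(G, D, L, β)`; nothing summit-bearing.

## Content

The two torus-side hypotheses of the Bessel cap (`GaugeBoot/BesselCap`: each link of `F` read EXACTLY ONCE by the word;
no two links of `F` read by a common plaquette) depend on the torus size `L`. For the certificates' fixed words they are
decided ONCE on `ℤ^d` and transported to every torus that is large compared with the word:

* `Step.edgeZ`, `Word.edgesReadZ v w` — the `ℤ^d`-edges read by `w` from the integer point `v`; `castEdge x E = (x + E.1 mod L, E.2)`;
  `Word.edgesRead (x + castZ v) w = (edgesReadZ v w).map (castEdge x)` (`Word.edgesRead_add_castZ`).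
* COUNT TRANSFER `Word.count_edgesRead_castEdge`: if all read `ℤ^d`-edges are within sup-distance `< L` of `E`, the torus
  count of `castEdge x E` equals the `ℤ^d` count of `E`.
* SHARE TRANSFER `shareZ_of_sharePlaquette`: the decidable `ℤ^d` relation `ShareZ E E'` (some `ℤ^d` plaquette through `E`
  reads `E'`) follows from `SharePlaquette (castEdge x E) (castEdge x E')` as soon as `|E.1 - E'.1|_∞ + 2 < L`.
-/

namespace Summit.QuantumFields.GaugeBoot

open Literature.MathematicalPhysics.QuantumFieldTheory

variable {d L : ℕ}

/-- An edge of `ℤ^d`: base point and direction. [folklore] -/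
abbrev EdgeZ (d : ℕ) : Type := (Fin d → ℤ) × Fin d

namespace Step

/-- The `ℤ^d`-edge read by a step taken from the integer point `v`. [folklore] -/
def edgeZ (v : Fin d → ℤ) : Step d → EdgeZ d
  | fwd μ => (v, μ)
  | bwd μ => (v - Pi.single μ 1, μ)

/-- Unfolding lemma `edgeZ_fwd`. [folklore] -/
@[simp] theorem edgeZ_fwd (v : Fin d → ℤ) (μ : Fin d) : (fwd μ).edgeZ v = (v, μ) := rfl

/-- Unfolding lemma `edgeZ_bwd`. [folklore] -/
@[simp] theorem edgeZ_bwd (v : Fin d → ℤ) (μ : Fin d) : (bwd μ).edgeZ v = (v - Pi.single μ 1, μ) := rfl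

/-- Unfolding lemma `dispZ_fwd`. [folklore] -/
@[simp] theorem dispZ_fwd' (μ : Fin d) : (fwd μ : Step d).dispZ = Pi.single μ 1 := rfl

/-- Unfolding lemma `dispZ_bwd`. [folklore] -/
@[simp] theorem dispZ_bwd' (μ : Fin d) : (bwd μ : Step d).dispZ = -Pi.single μ 1 := rfl

end Step

/-- The torus edge below a `ℤ^d`-edge, seen from the base point `x`: `(x + E.1 mod L, E.2)`. [folklore] -/
def castEdge (x : Site d L) (E : EdgeZ d) : Edge d L := (x + castZ E.1, E.2)

/-- Unfolding lemma `castEdge_apply`. [folklore] -/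
@[simp] theorem castEdge_apply (x : Site d L) (E : EdgeZ d) : castEdge x E = (x + castZ E.1, E.2) := rfl

/-- `castZ` commutes with subtraction. [folklore] -/
theorem castZ_sub (u v : Fin d → ℤ) : (castZ (u - v) : Site d L) = castZ u - castZ v := by
  funext i; simp [castZ]

/-- The torus edge read by a step from `x + v mod L` is the cast of the `ℤ^d`-edge read from `v`. [folklore] -/
theorem Step.edge_add_castZ (x : Site d L) (v : Fin d → ℤ) (s : Step d) :
    s.edge (x + castZ v) = castEdge x (s.edgeZ v) := by
  cases s with
  | fwd μ => rfl
  | bwd μ => simp [Step.edge, castZ_sub, castZ_single, add_sub_assoc]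

namespace Word

/-- The `ℤ^d`-edges read by the word `w` from the integer point `v`, in order and with multiplicity. [folklore] -/
def edgesReadZ : (Fin d → ℤ) → Word d → List (EdgeZ d)
  | _, [] => []
  | v, s :: w => s.edgeZ v :: edgesReadZ (v + s.dispZ) w

/-- Unfolding lemma `edgesReadZ_nil`. [folklore] -/
@[simp] theorem edgesReadZ_nil (v : Fin d → ℤ) : edgesReadZ v ([] : Word d) = [] := rfl

/-- Unfolding lemma `edgesReadZ_cons`. [folklore] -/
@[simp] theorem edgesReadZ_cons (v : Fin d → ℤ) (s : Step d) (w : Word d) :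
    edgesReadZ v (s :: w) = s.edgeZ v :: edgesReadZ (v + s.dispZ) w := rfl

/-- **The torus readings are the casts of the `ℤ^d` readings**: `edgesRead (x + v mod L) w = map (castEdge x) (edgesReadZ v w)`.
[folklore] -/
theorem edgesRead_add_castZ (x : Site d L) : ∀ (v : Fin d → ℤ) (w : Word d),
    edgesRead (x + castZ v) w = (edgesReadZ v w).map (castEdge x)
  | v, [] => rfl
  | v, s :: w => by
    rw [edgesRead_cons, edgesReadZ_cons, List.map_cons, Step.edge_add_castZ, Step.apply_eq_add_castZ, add_assoc,
      ← castZ_add, edgesRead_add_castZ x (v + s.dispZ) w]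

/-- From the base point itself: `edgesRead x w = map (castEdge x) (edgesReadZ 0 w)`. [folklore] -/
theorem edgesRead_eq_map_castEdge (x : Site d L) (w : Word d) :
    edgesRead x w = (edgesReadZ 0 w).map (castEdge x) := by
  rw [← edgesRead_add_castZ x 0 w, castZ_zero, add_zero]

/-- The `ℤ^d`-edges read by the plaquette word from `Y`: bottom, right, top, left. [folklore] -/
theorem edgesReadZ_plaquette (Y : Fin d → ℤ) (i j : Fin d) :
    edgesReadZ Y (plaquette i j) = [(Y, i), (Y + Pi.single i 1, j), (Y + Pi.single j 1, i), (Y, j)] := by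
  have h1 : Y + Pi.single i 1 + Pi.single j 1 - Pi.single i (1 : ℤ) = Y + Pi.single j 1 := by abel
  have h2 : Y + Pi.single i 1 + Pi.single j 1 + -Pi.single i (1 : ℤ) - Pi.single j 1 = Y := by abel
  show edgesReadZ Y [Step.fwd i, Step.fwd j, Step.bwd i, Step.bwd j] = _
  simp only [edgesReadZ_cons, edgesReadZ_nil, Step.edgeZ_fwd, Step.edgeZ_bwd, Step.dispZ_fwd', Step.dispZ_bwd', h1, h2]

end Word

/-! ## Count transfer -/

/-- Two `ℤ^d`-edges at sup-distance `< L` with the same cast are equal. [folklore] -/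
theorem eq_of_castEdge_eq (x : Site d L) {E E' : EdgeZ d} (hsmall : ∀ k, |E.1 k - E'.1 k| < L)
    (h : castEdge x E = castEdge x E') : E = E' := by
  simp only [castEdge_apply, Prod.mk.injEq, add_right_inj] at h
  exact Prod.ext ((castZ_eq_castZ_iff hsmall).1 h.1) h.2

/-- Counting through a map that is injective towards the counted element. [folklore] -/
theorem List.count_map_eq_of_inj_on {α β : Type*} [BEq α] [LawfulBEq α] [BEq β] [LawfulBEq β] (f : α → β) (a : α) :
    ∀ (l : List α), (∀ b ∈ l, f b = f a → b = a) → (l.map f).count (f a) = l.count a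
  | [], _ => by simp
  | b :: l, h => by
    rw [List.map_cons, List.count_cons, List.count_cons,
      List.count_map_eq_of_inj_on f a l fun c hc => h c (List.mem_cons_of_mem _ hc)]
    by_cases hb : b = a
    · subst hb; simp
    · have hfb : f b ≠ f a := fun hf => hb (h b List.mem_cons_self hf)
      rw [beq_eq_false_iff_ne.mpr hb, beq_eq_false_iff_ne.mpr hfb]

/-- **COUNT TRANSFER**: if every `ℤ^d`-edge read by `w` (from `0`) is at sup-distance `< L` from `E`, then the torus word read
from `x` traverses `castEdge x E` exactly as often as the `ℤ^d` word traverses `E`. [folklore] -/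
theorem Word.count_edgesRead_castEdge (x : Site d L) (w : Word d) (E : EdgeZ d)
    (hsmall : ∀ E' ∈ Word.edgesReadZ 0 w, ∀ k, |E'.1 k - E.1 k| < L) :
    (Word.edgesRead x w).count (castEdge x E) = (Word.edgesReadZ 0 w).count E := by
  rw [Word.edgesRead_eq_map_castEdge]
  exact List.count_map_eq_of_inj_on (castEdge x) E (Word.edgesReadZ 0 w)
    (fun E' hE' h => eq_of_castEdge_eq x (hsmall E' hE') h)

/-! ## Share transfer -/

/-- The three base points `E.1 - δ` of the `ℤ^d` plaquettes in the `{i,j}` plane whose boundary may read `E`: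
`δ ∈ {0, e_i, e_j}`. [folklore] -/
def plaqShifts (i j : Fin d) : List (Fin d → ℤ) := [0, Pi.single i 1, Pi.single j 1]

/-- `ℤ^d`-edges `E, E'` SHARE A PLAQUETTE on `ℤ^d`: some plaquette boundary word through `E` (in some plane `i < j`, based at
`E.1 - δ`, `δ ∈ {0, e_i, e_j}`) reads both — a DECIDABLE relation. [folklore] -/
def ShareZ (E E' : EdgeZ d) : Prop :=
  ∃ i j : Fin d, i < j ∧ ∃ δ ∈ plaqShifts i j,
    E ∈ Word.edgesReadZ (E.1 - δ) (Word.plaquette i j) ∧ E' ∈ Word.edgesReadZ (E.1 - δ) (Word.plaquette i j)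

/-- `ShareZ` is decidable (finitely many planes and shifts). [folklore] -/
instance ShareZ.decidable (E E' : EdgeZ d) : Decidable (ShareZ E E') := by
  unfold ShareZ; infer_instance

/-- A torus plaquette reading `castEdge x E` is the cast of a `ℤ^d` plaquette through `E`: its base point is
`x + castZ (E.1 - δ)` with `δ ∈ {0, e_i, e_j}` and that `ℤ^d` plaquette reads `E`. [folklore] -/
theorem exists_shift_of_mem_edgesRead_plaquette (x y : Site d L) (i j : Fin d) (E : EdgeZ d)
    (h : castEdge x E ∈ Word.edgesRead y (Word.plaquette i j)) :
    ∃ δ ∈ plaqShifts i j, y = x + castZ (E.1 - δ) ∧ E ∈ Word.edgesReadZ (E.1 - δ) (Word.plaquette i j) := by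
  obtain ⟨u, μ⟩ := E
  rw [Word.edgesRead_plaquette] at h
  simp only [castEdge_apply, List.mem_cons, Prod.mk.injEq, List.not_mem_nil, or_false] at h
  simp only [plaqShifts, List.mem_cons, List.not_mem_nil, or_false, exists_eq_or_imp, exists_eq_left,
    Word.edgesReadZ_plaquette, Prod.mk.injEq, sub_zero]
  rcases h with ⟨h1, h2⟩ | ⟨h1, h2⟩ | ⟨h1, h2⟩ | ⟨h1, h2⟩
  · exact Or.inl ⟨h1.symm, by simp [h2]⟩
  · refine Or.inr (Or.inl ⟨?_, by simp [h2]⟩)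
    rw [castZ_sub, castZ_single, ← add_sub_assoc, h1]; simp [Site.shift]
  · refine Or.inr (Or.inr ⟨?_, by simp [h2]⟩)
    rw [castZ_sub, castZ_single, ← add_sub_assoc, h1]; simp [Site.shift]
  · exact Or.inl ⟨h1.symm, by simp [h2]⟩

/-- The `ℤ^d`-edges of a plaquette based at `E.1 - δ` (`δ ∈ {0, e_i, e_j}`) are within sup-distance `2` of `E`... more
precisely each coordinate of their base point differs from that of `E.1` by at most `2`. [folklore] -/
theorem abs_sub_le_two_of_mem_plaquette {i j : Fin d} {δ : Fin d → ℤ} (hδ : δ ∈ plaqShifts i j) (E : EdgeZ d)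
    {E'' : EdgeZ d} (h : E'' ∈ Word.edgesReadZ (E.1 - δ) (Word.plaquette i j)) (k : Fin d) :
    |E''.1 k - E.1 k| ≤ 2 := by
  have hs : ∀ (μ : Fin d), |(Pi.single μ (1 : ℤ) : Fin d → ℤ) k| ≤ 1 := fun μ => by
    by_cases hk : k = μ
    · subst hk; simp
    · simp [hk]
  have hδk : |δ k| ≤ 1 := by
    simp only [plaqShifts, List.mem_cons, List.not_mem_nil, or_false] at hδ
    rcases hδ with rfl | rfl | rfl
    · simp
    · exact hs i
    · exact hs j
  rw [Word.edgesReadZ_plaquette] at h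
  simp only [List.mem_cons, List.not_mem_nil, or_false] at h
  have hi := hs i
  have hj := hs j
  rw [abs_le] at hδk hi hj ⊢
  rcases h with rfl | rfl | rfl | rfl <;> simp only [Pi.sub_apply, Pi.add_apply] <;> constructor <;> linarith

/-- **SHARE TRANSFER**: if the torus edges below `E` and `E'` are read by a common torus plaquette and
`|E.1 - E'.1|_∞ + 2 < L`, then `E` and `E'` share a plaquette on `ℤ^d` (`ShareZ`, decidable). [folklore] -/
theorem shareZ_of_sharePlaquette [NeZero L] (x : Site d L) {E E' : EdgeZ d} (hsmall : ∀ k, |E.1 k - E'.1 k| + 2 < L)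
    (h : SharePlaquette (castEdge x E) (castEdge x E')) : ShareZ E E' := by
  obtain ⟨⟨y, ⟨⟨i, j⟩, hij⟩⟩, hE, hE'⟩ := h
  change castEdge x E ∈ Word.edgesRead y (Word.plaquette i j) at hE
  change castEdge x E' ∈ Word.edgesRead y (Word.plaquette i j) at hE'
  obtain ⟨δ, hδ, hy, hEZ⟩ := exists_shift_of_mem_edgesRead_plaquette x y i j E hE
  refine ⟨i, j, hij, δ, hδ, hEZ, ?_⟩
  rw [hy, Word.edgesRead_add_castZ, List.mem_map] at hE'
  obtain ⟨E'', hE'', hcast⟩ := hE'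
  have hEq : E'' = E' := eq_of_castEdge_eq x (fun k => by
    have h2 := abs_sub_le_two_of_mem_plaquette hδ E hE'' k
    have h3 := hsmall k
    have : |E''.1 k - E'.1 k| ≤ |E''.1 k - E.1 k| + |E.1 k - E'.1 k| := by
      have := abs_sub_le (E''.1 k) (E.1 k) (E'.1 k); exact this
    have h2' : (|E''.1 k - E.1 k| : ℤ) ≤ 2 := h2
    linarith) hcast
  rw [← hEq]
  exact hE''

end Summit.QuantumFields.GaugeBoot
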